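import Summits.BirchSwinnertonDyer.Rank1Residual.P2.CMKolyvaginCartanCommuteAtTwoClasses
import Literature.NumberTheory.EllipticCurves.TwoAdicImageSurjectivityModTwoProofs
import Literature.NumberTheory.EllipticCurves.TateModuleGaloisTransportProofs
import Summits.BirchSwinnertonDyer.BirchSwinnertonDyer.Theorems.CMKolyvaginAtInertTwoCartanAtTwoPowAnti
import Summits.BirchSwinnertonDyer.BirchSwinnertonDyer.Theorems.CMKolyvaginAtInertTwoInertOrderSplittingH1
import HarnessLib

/-!
# Route `CMKolyvaginAtInertTwo`, crux `CMKolyvaginExactAtInertTwo` (stmt-BirchSwinnertonDyer-24277):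
# the inert-order splitting ON THE HABITAT — over a number field `K ∋ √Δ_E` the whole Galois group
# `Γ_K` commutes with the CM generator `η` (CARTAN at every level `2^M`), lifts of an involution `σ` of
# `K` acting on `E[2]` as a transposition conjugate `η` to `η̄`, and hence `H¹(K, E[2^M])` is a
# `ℤ/2^M[η]⟨σ⟩`-module: `H¹^{σ} = (1+σ_*)H¹` and `#S = (#S^{σ})²` for every finite `σ_*`-, `η_*`-stable `S`

Seat `bsd-line-cmk2-p1` g10 (cell `bsd-print-cf2`); helper (`--supports stmt-BirchSwinnertonDyer-24277`).
THEOREMS ONLY: no definition, no named fact, no `sorry`; no item is closed; BSD is not proved by this.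
Memo `Cruxes/CMExactDescentAtTwo/MEMO-inert-order-splitting.md` §3–§4 (steps 4.1–4.2).

* §1 `smul_trivial_or_fixedPointFree_of_isSquare_Δ` — over a perfect field `K'` with `√Δ ∈ K'`, every
  `γ ∈ Γ_{K'}` is an EVEN permutation of `E[2] ∖ 0` (Dokchitser–Dokchitser's `δ`, `σδ = sign(σ)δ`), i.e. acts
  trivially on `E[2]` or without non-zero fixed point.
* §2 `exists_cmGenerator_baseChange` — for `E/ℚ` with `j ∈` the maximal CM invariants, `d = cmDiscr j`
  odd (`2` inert in `ℤ[ω_d]`), and a number field `K ∋ √Δ_E`: a `Γ_K`-EQUIVARIANT `η_K` on `E_K(K̄)` with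
  `η_K² − dη_K = −c` (`4c = d(d−1)`): transport of ty2's CM generator along `E(ℚ̄) ≃ E_K(K̄)` and §1 +
  `CartanAtTwo.commute_of_fixedPointFree/commute_of_trivial`. (CARTAN: `Γ_K` acts `ℤ[η]`-linearly on every `E[2^M]`.)
* §3 `anti_pointsMap_of_lift` — for any `Γ_K`-equivariant `η` with `η² + mη = c` (`m, c` odd), a lift `τ̃`
  of `σ ∈ Aut(K/ℚ)` acting on `E_K[2]` with a fixed non-zero point and a moved point, and some `z ∈ Γ_K`
  without non-zero fixed point on `E_K[2]`: `η(τ̃P) = −τ̃(ηP) − m·τ̃P` on `E_K[2^M]` (the engine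
  `CartanAtTwoPow.anti_of_transposition_of_normalizer` with `z' = τ̃⁻¹zτ̃`).
* §4 `natCard_stable_eq_sq_of_lift`, `fixed_iff_exists_add_conjAct_of_lift` — §3 fed into
  `InertOrderSplittingH1`: **`#S = (#S^{σ})²`** for finite `σ_*`-, `η_*`-stable `S ≤ H¹(K, E_K[2^M])` and
  **`H¹(K,E_K[2^M])^{σ} = (1 + σ_*)H¹(K,E_K[2^M])`**.

Consumers (next seats): `K = L = K_Heegner·F` on `H₂`, `σ` = complex conjugation of `L` or `Gal(L/K_Heegner)`,
`S = Sel_{2^M}(E/L)` (stable: `η` is an `L`-endomorphism, `σ` permutes places) — the exact splitting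
`#Sel_{2^M}(E/L) = (#Sel_{2^M}(E/L)^{σ})²` of the memo's Morita frame; the two displayed hypotheses on `τ̃`
and `z` are discharged there by `Δ < 0` (complex conjugation is a transposition on `E[2]`) and `ρ̄₂(Γ_L) = A₃`.
References: Lang, *Elliptic Functions*, Ch. 10 §4 Remark [Lang1987]; T. & V. Dokchitser, Math. Z. 2012
(`ℚ(E[2]) ⊃ ℚ(√Δ)`) [DokchitserDokchitserMathZ2012]; Silverman *AEC* III.§4, III.§7 [SilvermanAEC2009].
-/

-- single-conjunct summit: `Summit.BirchSwinnertonDyer.BirchSwinnertonDyer.…` repeats the name by design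
set_option linter.dupNamespace false
set_option autoImplicit false

noncomputable section

open scoped Classical

namespace Summit.BirchSwinnertonDyer.BirchSwinnertonDyer.Theorems.InertOrderSplittingHabitat

open WeierstrassCurve Field
open Literature.NumberTheory.EllipticCurves
open Literature.NumberTheory.EllipticCurves.DokchitserDokchitser2012
open Literature.NumberTheory.GaloisRepresentations
open Summit.BirchSwinnertonDyer.Rank1Residual.P2.CartanAtTwo
open Summit.BirchSwinnertonDyer.BirchSwinnertonDyer.Theorems.CartanAtTwoPow

universe u

/-! ## §1 Over a field containing `√Δ`, Galois acts on `E[2]` by even permutations -/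

/-- An even permutation of three letters is the identity or has no fixed point. [folklore] -/
theorem perm_three_eq_one_or_fixedPointFree (p : Equiv.Perm (Fin 3)) (hp : Equiv.Perm.sign p = 1) :
    p = 1 ∨ ∀ i, p i ≠ i := by
  revert hp
  revert p
  decide

section EvenAction

variable {K' : Type u} [Field K'] [PerfectField K'] (V : WeierstrassCurve K') [V.IsElliptic]

/-- **`√Δ ∈ K'` ⟹ every `γ ∈ Γ_{K'}` acts on `E[2]` trivially or without non-zero fixed point** (it fixes
`δ = ∏_{i<j}(x_i − x_j)`, `(4δ)² = Δ`, hence permutes `E[2] ∖ 0` evenly).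
[cite: DokchitserDokchitserMathZ2012, Theorem (1), proof (ℚ(E[2]) ⊃ ℚ(√Δ))] -/
theorem smul_trivial_or_fixedPointFree_of_isSquare_Δ (h2 : (2 : K') ≠ 0) (hΔ : IsSquare V.Δ)
    (γ : absoluteGaloisGroup K') :
    (∀ P : geomPoints V, (2 : ℤ) • P = 0 → γ • P = P) ∨
      (∀ P : geomPoints V, (2 : ℤ) • P = 0 → γ • P = P → P = 0) := by
  have hδ : γ • delta V h2 = delta V h2 := (isSquare_Δ_iff_forall_smul_delta V h2).mp hΔ γ
  have hsign : Equiv.Perm.sign (permGal V h2 γ) = 1 := by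
    rcases Int.units_eq_one_or (Equiv.Perm.sign (permGal V h2 γ)) with h | h
    · exact h
    · exfalso
      rw [smul_delta, h] at hδ
      simp only [Units.val_neg, Units.val_one, Int.cast_neg, Int.cast_one, neg_mul, one_mul] at hδ
      have h2' : (2 : AlgebraicClosure K') ≠ 0 := by
        rw [show (2 : AlgebraicClosure K') = algebraMap K' (AlgebraicClosure K') 2 from
          (map_ofNat (algebraMap K' (AlgebraicClosure K')) 2).symm]
        exact (map_ne_zero _).mpr h2
      apply mul_ne_zero h2' (delta_ne_zero V h2)
      linear_combination -hδ
  have mem : ∀ {P : geomPoints V}, (2 : ℤ) • P = 0 → P ∈ geomTorsion V 2 := fun h ↦ by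
    rw [mem_geomTorsion_iff]; exact h
  rcases perm_three_eq_one_or_fixedPointFree _ hsign with h1 | hfpf
  · left
    intro P h2P
    rcases eq_zero_or_eq_T V h2 ⟨P, mem h2P⟩ with h0 | ⟨i, hi⟩
    · have : P = 0 := congrArg Subtype.val h0
      rw [this, smul_zero]
    · have hP : P = (T V h2 i : geomPoints V) := congrArg Subtype.val hi
      rw [hP, ← coe_T_permGal, h1, Equiv.Perm.one_apply]
  · right
    intro P h2P hfix
    rcases eq_zero_or_eq_T V h2 ⟨P, mem h2P⟩ with h0 | ⟨i, hi⟩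
    · exact congrArg Subtype.val h0
    · exfalso
      have hP : P = (T V h2 i : geomPoints V) := congrArg Subtype.val hi
      have h := hfix
      rw [hP, ← coe_T_permGal] at h
      exact hfpf i (T_injective V h2 (Subtype.ext h))

end EvenAction

/-! ## §2 CARTAN over `K ∋ √Δ`: an equivariant CM generator on `E_K(K̄)` -/

section Cartan

variable (W : WeierstrassCurve ℚ) [W.IsElliptic]

/-- **An equivariant CM generator over a number field containing `√Δ`.** For `E/ℚ` with `j(E)` one of
the maximal CM invariants, `d = cmDiscr j(E)` ODD and `4c = d(d−1)` with `c` odd (the orders `ℤ[ω_d]`,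
`d ≡ 5 (mod 8)`, in which `2` is inert), and a number field `K` with `Δ_E ∈ K^{×2}`: there is an additive
endomorphism `η` of `E_K(K̄)` with `η(ηP) − d·ηP = −c·P` commuting with EVERY element of `Γ_K` — `Γ_K`
acts `ℤ[η]`-linearly on each `E_K[2^M]`, i.e. through the Cartan `(ℤ/2^M[η])ˣ`. (Transport of ty2's
`exists_cmGenerator_of_mem_maximalCMJInvariants` along `E(ℚ̄) ≃ E_K(K̄)`, `Γ_K`-equivariant since every
`γ ∈ Γ_K` is even on `E[2]` (§1) and even elements commute with `η` by the dichotomy.)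
[cite: Lang1987, Ch. 10 §4, Remark] [cite: DokchitserDokchitserMathZ2012, Theorem (1)] -/
theorem exists_cmGenerator_baseChange (hj : W.j ∈ maximalCMJInvariants) {d c : ℤ}
    (hd : cmDiscr W.j = d) (hc : d * (d - 1) = 4 * c) (hodd : Odd d) (hoddc : Odd c)
    (K : Type) [Field K] [NumberField K] (hΔ : IsSquare (W.baseChange K).Δ) :
    ∃ η : AddMonoid.End (geomPoints (W.baseChange K)),
      (∀ P : geomPoints (W.baseChange K), η (η P) + (-d) • η P = (-c) • P) ∧
      (∀ (γ : absoluteGaloisGroup K) (P : geomPoints (W.baseChange K)), γ • η P = η (γ • P)) := by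
  haveI : (W.baseChange K).IsElliptic := by rw [baseChange]; infer_instance
  subst hd
  obtain ⟨η₀, hη₀, hrel₀⟩ := exists_cmGenerator_of_mem_maximalCMJInvariants W hj hc
  have hrel : ∀ P : geomPoints W, η₀ (η₀ P) + (-cmDiscr W.j) • η₀ P = (-c) • P := rel_apply W hrel₀
  have hcard : Nat.card (geomTorsion W ((2 : ℕ) : ℤ)) = 4 := by simpa using natCard_geomTorsion_two_pow W 1
  obtain ⟨e, he⟩ := WeierstrassCurve.exists_addEquiv_geomPoints_baseChange W K
  have he' : ∀ (γ : absoluteGaloisGroup K) (Q : geomPoints (W.baseChange K)),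
      e.symm (γ • Q) = absGaloisRestrict ℚ K γ • e.symm Q := fun γ Q ↦ by
    apply e.injective
    rw [he, AddEquiv.apply_symm_apply, AddEquiv.apply_symm_apply]
  refine ⟨(e : geomPoints W →+ geomPoints (W.baseChange K)).comp
      (η₀.comp (e.symm : geomPoints (W.baseChange K) →+ geomPoints W)), fun P ↦ ?_, fun γ P ↦ ?_⟩
  · change e (η₀ (e.symm (e (η₀ (e.symm P))))) + (-cmDiscr W.j) • e (η₀ (e.symm P)) = (-c) • P
    rw [AddEquiv.symm_apply_apply, ← map_zsmul, ← map_add, hrel, map_zsmul, AddEquiv.apply_symm_apply]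
  · change γ • e (η₀ (e.symm P)) = e (η₀ (e.symm (γ • P)))
    -- `res γ` is even on `E[2](ℚ̄)`, hence commutes with `η₀`
    have h2K : (2 : K) ≠ 0 := two_ne_zero
    have hcomm : ∀ R : geomPoints W, absGaloisRestrict ℚ K γ • η₀ R = η₀ (absGaloisRestrict ℚ K γ • R) := by
      rcases smul_trivial_or_fixedPointFree_of_isSquare_Δ (W.baseChange K) h2K hΔ γ with htriv | hfpf
      · refine commute_of_trivial hodd.neg hcard (dichotomy W hη₀ hrel₀ _) fun R h2R ↦ ?_
        apply e.injective
        rw [he, htriv _ (by rw [← map_zsmul, h2R, map_zero])]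
      · refine commute_of_fixedPointFree hrel hodd.neg hoddc.neg hcard (dichotomy W hη₀ hrel₀ _)
          fun R h2R hfix ↦ ?_
        have h : e R = 0 := hfpf (e R) (by rw [← map_zsmul, h2R, map_zero]) (by rw [← he, hfix])
        exact e.injective (by rw [h, map_zero])
    rw [← he, hcomm, ← he']

end Cartan

/-! ## §3 Lifts of `σ` that are transpositions on `E[2]` conjugate `η` to `η̄` -/

section Anti

variable (W : WeierstrassCurve ℚ) [W.IsElliptic] {K : Type} [Field K] [NumberField K]
variable {σ : K ≃ₐ[ℚ] K} {τ : AlgebraicClosure K ≃+* AlgebraicClosure K}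

/-- **`η(τ̃P) = −τ̃(ηP) − m·τ̃P` on `E_K[2^M]` for a lift `τ̃` of `σ ∈ Aut(K/ℚ)`** which fixes a non-zero
point of `E_K[2]` and moves one, given `z ∈ Γ_K` without non-zero fixed point on `E_K[2]` and a
`Γ_K`-equivariant `η` with `η² + mη = c` (`m, c` odd): the engine with `t = τ̃` on points, `z' = τ̃⁻¹ z τ̃`
(`IsLiftOfAut.pointsMap_smul`). [cite: Lang1987, Ch. 10 §4, Remark] -/
theorem anti_pointsMap_of_lift (hτ : IsLiftOfAut σ τ) {η : AddMonoid.End (geomPoints (W.baseChange K))}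
    {m c : ℤ} (hrel : ∀ P : geomPoints (W.baseChange K), η (η P) + m • η P = c • P) (hm : Odd m) (hc : Odd c)
    (hη : ∀ (γ : absoluteGaloisGroup K) (P : geomPoints (W.baseChange K)), γ • η P = η (γ • P))
    {z : absoluteGaloisGroup K}
    (hz : ∀ P : geomPoints (W.baseChange K), (2 : ℤ) • P = 0 → z • P = P → P = 0)
    (hfix : ∃ X₀ : geomPoints (W.baseChange K), X₀ ≠ 0 ∧ (2 : ℤ) • X₀ = 0 ∧ hτ.pointsMap W X₀ = X₀)
    (hmove : ∃ Y₁ : geomPoints (W.baseChange K), (2 : ℤ) • Y₁ = 0 ∧ hτ.pointsMap W Y₁ ≠ Y₁)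
    (M : ℕ) (P : geomPoints (W.baseChange K)) (hP : (2 : ℤ) ^ M • P = 0) :
    η (hτ.pointsMap W P) = -hτ.pointsMap W (η P) - m • hτ.pointsMap W P := by
  haveI : (W.baseChange K).IsElliptic := by rw [baseChange]; infer_instance
  have ht : Function.Injective (hτ.pointsMap W) := by
    refine (injective_iff_map_eq_zero _).mpr fun P hP ↦ ?_
    change ((W.baseChange K).baseChange (AlgebraicClosure K)).toAffine.Point at P
    rcases P with _ | ⟨x, y, h⟩
    · rfl
    · exact absurd hP (by rintro ⟨⟩)
  have hconj : ∀ Q : geomPoints (W.baseChange K), hτ.pointsMap W (hτ.conjGalCMH z • Q) = z • hτ.pointsMap W Q :=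
    hτ.pointsMap_smul W z
  have hz' : ∀ Q : geomPoints (W.baseChange K), (2 : ℤ) • Q = 0 → hτ.conjGalCMH z • Q = Q → Q = 0 := by
    intro Q h2Q hfixQ
    have h2 : (2 : ℤ) • hτ.pointsMap W Q = 0 := by rw [← map_zsmul, h2Q, map_zero]
    have hfx : z • hτ.pointsMap W Q = hτ.pointsMap W Q := by rw [← hconj, hfixQ]
    exact ht (by rw [hz _ h2 hfx, map_zero])
  exact anti_of_transposition_of_normalizer hrel hm hc (hτ.pointsMap W) ht (hη z) (hη (hτ.conjGalCMH z))
    hz' hconj hfix hmove M P hP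

/-- The same at the level of `n`-torsion SUBGROUPS (`n = 2^M`), for an endomorphism `ηn` of `E_K[n]`
agreeing with `η`, against `IsLiftOfAut.torsionMap` — the hypothesis `hanti` of
`InertOrderSplittingH1.conjAct_anti` / `natCard_stable_eq_sq` VERBATIM. [cite: Lang1987, Ch. 10 §4, Remark] -/
theorem anti_torsionMap_of_lift (hτ : IsLiftOfAut σ τ) {η : AddMonoid.End (geomPoints (W.baseChange K))}
    {m c : ℤ} (hrel : ∀ P : geomPoints (W.baseChange K), η (η P) + m • η P = c • P) (hm : Odd m) (hc : Odd c)
    (hη : ∀ (γ : absoluteGaloisGroup K) (P : geomPoints (W.baseChange K)), γ • η P = η (γ • P))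
    {z : absoluteGaloisGroup K}
    (hz : ∀ P : geomPoints (W.baseChange K), (2 : ℤ) • P = 0 → z • P = P → P = 0)
    (hfix : ∃ X₀ : geomPoints (W.baseChange K), X₀ ≠ 0 ∧ (2 : ℤ) • X₀ = 0 ∧ hτ.pointsMap W X₀ = X₀)
    (hmove : ∃ Y₁ : geomPoints (W.baseChange K), (2 : ℤ) • Y₁ = 0 ∧ hτ.pointsMap W Y₁ ≠ Y₁)
    (M : ℕ) (ηn : geomTorsion (W.baseChange K) ((2 : ℤ) ^ M) →+ geomTorsion (W.baseChange K) ((2 : ℤ) ^ M))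
    (hηn : ∀ P : geomTorsion (W.baseChange K) ((2 : ℤ) ^ M), (ηn P : geomPoints (W.baseChange K)) = η P)
    (P : geomTorsion (W.baseChange K) ((2 : ℤ) ^ M)) :
    ηn (hτ.torsionMap W _ P) = -hτ.torsionMap W _ (ηn P) - m • hτ.torsionMap W _ P := by
  apply Subtype.ext
  rw [hηn, IsLiftOfAut.coe_torsionMap, AddSubgroup.coe_sub, AddSubgroup.coe_neg, AddSubgroupClass.coe_zsmul,
    IsLiftOfAut.coe_torsionMap, IsLiftOfAut.coe_torsionMap, hηn]
  exact anti_pointsMap_of_lift W hτ hrel hm hc hη hz hfix hmove M P ((mem_geomTorsion_iff _ _ _).mp P.2)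

end Anti

/-! ## §4 `H¹(K, E_K[2^M])` is a `ℤ/2^M[η]⟨σ⟩`-module: the exact splitting -/

section H1

variable (W : WeierstrassCurve ℚ) [W.IsElliptic] {K : Type} [Field K] [NumberField K]
variable {σ : K ≃ₐ[ℚ] K} {τ : AlgebraicClosure K ≃+* AlgebraicClosure K}

/-- **`#S = (#S^{σ})²` for every finite `σ_*`-, `η_*`-stable `S ≤ H¹(K, E_K[2^M])`** — `InertOrderSplittingH1.natCard_stable_eq_sq`
with its hypothesis `hanti` DISCHARGED by §3: inputs are an involution `σ` of the number field `K`, a lift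
`τ̃` acting on `E_K[2]` with a fixed non-zero point and a moved point, `z ∈ Γ_K` without non-zero fixed
point on `E_K[2]`, and a `Γ_K`-equivariant `η` with `η² + mη = c`, `m, c` odd (§2 on the habitat).
[cite: Lang1987, Ch. 10 §4, Remark] -/
theorem natCard_stable_eq_sq_of_lift (hσ : σ * σ = 1) (hτ : IsLiftOfAut σ τ)
    {η : AddMonoid.End (geomPoints (W.baseChange K))} {k₀ c : ℤ}
    (hrel : ∀ P : geomPoints (W.baseChange K), η (η P) + (2 * k₀ + 1) • η P = c • P) (hc : Odd c)
    (hη : ∀ (γ : absoluteGaloisGroup K) (P : geomPoints (W.baseChange K)), γ • η P = η (γ • P))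
    {z : absoluteGaloisGroup K}
    (hz : ∀ P : geomPoints (W.baseChange K), (2 : ℤ) • P = 0 → z • P = P → P = 0)
    (hfix : ∃ X₀ : geomPoints (W.baseChange K), X₀ ≠ 0 ∧ (2 : ℤ) • X₀ = 0 ∧ hτ.pointsMap W X₀ = X₀)
    (hmove : ∃ Y₁ : geomPoints (W.baseChange K), (2 : ℤ) • Y₁ = 0 ∧ hτ.pointsMap W Y₁ ≠ Y₁)
    (M : ℕ) (ηn : geomTorsion (W.baseChange K) ((2 : ℤ) ^ M) →+ geomTorsion (W.baseChange K) ((2 : ℤ) ^ M))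
    (hηn : ∀ P : geomTorsion (W.baseChange K) ((2 : ℤ) ^ M), (ηn P : geomPoints (W.baseChange K)) = η P)
    (hηnG : ∀ (x : absoluteGaloisGroup K) (P : geomTorsion (W.baseChange K) ((2 : ℤ) ^ M)),
      ηn (ContinuousMonoidHom.id (absoluteGaloisGroup K) x • P) = x • ηn P)
    (S : AddSubgroup (galH1Torsion (W.baseChange K) ((2 : ℤ) ^ M)))
    (hSσ : ∀ x ∈ S, conjAct W σ _ x ∈ S)
    (hSη : ∀ x ∈ S, resH1Hom (ContinuousMonoidHom.id _) ηn hηnG x ∈ S) :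
    Nat.card S = Nat.card {x : S // conjAct W σ _ (x : galH1Torsion (W.baseChange K) ((2 : ℤ) ^ M)) = x} ^ 2 :=
  InertOrderSplittingH1.natCard_stable_eq_sq W hσ hτ M k₀ c ηn hηnG
    (fun P ↦ Subtype.ext (by
      simp only [AddSubgroup.coe_add, AddSubgroupClass.coe_zsmul, hηn]
      exact hrel _))
    (anti_torsionMap_of_lift W hτ hrel ⟨k₀, by ring⟩ hc hη hz hfix hmove M ηn hηn) S hSσ hSη

/-- **`H¹(K, E_K[2^M])^{σ} = (1 + σ_*) H¹(K, E_K[2^M])`** on the habitat (`Ĥ⁰(⟨σ⟩, H¹) = 0`).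
[cite: Lang1987, Ch. 10 §4, Remark] -/
theorem fixed_iff_exists_add_conjAct_of_lift (hσ : σ * σ = 1) (hτ : IsLiftOfAut σ τ)
    {η : AddMonoid.End (geomPoints (W.baseChange K))} {k₀ c : ℤ}
    (hrel : ∀ P : geomPoints (W.baseChange K), η (η P) + (2 * k₀ + 1) • η P = c • P) (hc : Odd c)
    (hη : ∀ (γ : absoluteGaloisGroup K) (P : geomPoints (W.baseChange K)), γ • η P = η (γ • P))
    {z : absoluteGaloisGroup K}
    (hz : ∀ P : geomPoints (W.baseChange K), (2 : ℤ) • P = 0 → z • P = P → P = 0)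
    (hfix : ∃ X₀ : geomPoints (W.baseChange K), X₀ ≠ 0 ∧ (2 : ℤ) • X₀ = 0 ∧ hτ.pointsMap W X₀ = X₀)
    (hmove : ∃ Y₁ : geomPoints (W.baseChange K), (2 : ℤ) • Y₁ = 0 ∧ hτ.pointsMap W Y₁ ≠ Y₁)
    (M : ℕ) (ηn : geomTorsion (W.baseChange K) ((2 : ℤ) ^ M) →+ geomTorsion (W.baseChange K) ((2 : ℤ) ^ M))
    (hηn : ∀ P : geomTorsion (W.baseChange K) ((2 : ℤ) ^ M), (ηn P : geomPoints (W.baseChange K)) = η P)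
    (hηnG : ∀ (x : absoluteGaloisGroup K) (P : geomTorsion (W.baseChange K) ((2 : ℤ) ^ M)),
      ηn (ContinuousMonoidHom.id (absoluteGaloisGroup K) x • P) = x • ηn P)
    (x : galH1Torsion (W.baseChange K) ((2 : ℤ) ^ M)) :
    conjAct W σ _ x = x ↔ ∃ y, x = y + conjAct W σ _ y :=
  InertOrderSplittingH1.fixed_iff_exists_add_conjAct W _ ηn hηnG hσ hτ k₀
    (anti_torsionMap_of_lift W hτ hrel ⟨k₀, by ring⟩ hc hη hz hfix hmove M ηn hηn) x

end H1

end Summit.BirchSwinnertonDyer.BirchSwinnertonDyer.Theorems.InertOrderSplittingHabitat
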